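import Literature.MathematicalPhysics.QuantumFieldTheory.Balaban1983to89.B7Eq123GeneralRec
import Literature.MathematicalPhysics.QuantumFieldTheory.Balaban1983to89.B8Eq156Prop4

/-!
# `Balaban1983to89.B8Eq156Prop4Rec` — RECORD TWIN of `B8Eq156Prop4` §1–§3 ([Balaban1985RegularSpaces] p. 86: the step (1.56) «Proposition 4 from [3] implies
# Q_j(U₀, ηA) = LʲηQ_jA + C_j(LʲηA), |C_j(LʲηA)| ≦ C₂|LʲηA|² < C₂α₂²» and «B₁ = B − C_j(LʲηA) on Λ_j, |B₁| < 2dLα₁ + C₂α₂²») for the SYMMETRISED CENTRED block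
# averaging (0.4) of [Balaban1987RG1] — with the RECORD's Prop-4 windows and constants (director-ym №267: «(128)∕(130)∕(131) hold for the record k-uniformly with
# constants ×(1+4dL)»)

statement-level skeleton of published theorems with citation tags; proofs where landed; nothing here is a claim about the Yang–Mills mass gap

T. Bałaban, *Spaces of regular gauge field configurations on a lattice and gauge fixing conditions*, Commun. Math. Phys. **99** (1985) 75–102
`[Balaban1985RegularSpaces]` ("[6]"): (1.56) p. 86 and the sentence after it, (1.40)–(1.42) p. 83; T. Bałaban, *Averaging operations for lattice gauge theories*, Commun. Math.
Phys. **98** (1985) 17–51 `[Balaban1985Averaging]` ("[3]"): Prop. 4 (130)–(131) p. 38; T. Bałaban, *Renormalization group approach to lattice gauge field theories. I*,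
Commun. Math. Phys. **109** (1987) 249–301 `[Balaban1987RG1]` ("[I]"): (0.3)–(0.4) pp. 252–253, pp. 253–254.  STATUS: published, refereed.

CITATION HEADER (lean-in-tree rule).  Cell `pub-ymgap`, base `pub-ymgap-dag-n05-c` g26 — N05-REC stage 2 (director-ym №254∕№255∕№265∕№267), item R5 sub-chain β, LEAD
PEN dag-n05-e (inventory `N05-REC-INVENTORY.md` e50db04501ab292d §R5 row `B8Eq156Prop4`: A `B1_eq eq156_of_141 eq156_A eq156`).  WHAT IS REPRODUCED = ✓`B8Eq156Prop4` §1–§3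
over dag-n05-e's `B7Eq123GeneralRec.prop4_generalZ` ([3] Prop. 4 for the record, k-uniform): `logCovIter ∕ linCovIter ↦ logCovIterZ ∕ linCovIterZ`, `AvgClosed ↦ AvgClosedZ`, and
the RECORD's windows in place of the engine's — odd `L = 2s+1` with `1 ≤ s`, `1 ≤ d`, `C0Z d·α₀ ≤ 1∕3`, `e^{4·cZ(d)·α₀}(1 + 2C₁·KZ(d,L)²·Lʲb) ≤ 2`, `KZ(d,L)·Lʲb ≤ c₃(d,L)`
(`C₁ = 131072(d+1)²`, `cZ ∕ gZ ∕ KZ` of `B7Prop4GeneralLevelsRec`); the (1.56) constant becomes `C₂ᶻ := (1 + 2gZ(d,L))·2C₁·KZ(d,L)²·e^{4·cZ(d)·α₀}` and (131)'s `2` becomes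
`KZ(d,L)`.  Declaration names = engine names (T5); proofs = the engine's lines over `prop4_generalZ`.  The engine's §4 (`apriori_160_of_156(_unitary)`, `ineq1143`, `plaq_le_of_pdev`)
is structure-free bookkeeping over these and is NOT on the record crown's path; not twinned here.  Kind «kernel-checked proof», theorems only; no `def`, no `instance`, no
`notation`, no existing module modified.  `--supports stmt-QuantumFields-20541` (K0⁷-keyed, COUNT-NEUTRAL).

HONEST SCOPE: the β head — one application of the landed record Prop 4 per declaration + triangle inequalities; nothing of Bałaban's analysis re-proved here; `HThm4Rec`
UNDISCHARGED; caveat (C-S3-1) + addendum v4 («hybrid record — (128)∕(130)∕(131) hold for the record k-uniformly with constants ×(1+4dL); the carried coarse gauge letter Λ_j is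
absorbed into the data B₁ of (1.56) by the Stokes estimate; flat-letter layer off the path modulo N2a–c»); N05 [B8] DISCHARGED OF RECORD untouched; COUNT of record unmoved · K
numerically unchanged; one finite `𝕋⁴` programme at fixed `ε`, Bałaban AS PRINTED; nothing continuum ∕ ℝ⁴ ∕ OS ∕ mass-gap ∕ Clay.  No `sorry`, no `def`.

[cite: Balaban1985RegularSpaces, (1.56) p.86, (1.40)–(1.42) p.83; Balaban1985Averaging, Prop. 4 (130)–(131) p.38; Balaban1987RG1, (0.3)–(0.4) pp.252–253]
-/

noncomputable section

open scoped BigOperators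
open NormedSpace

namespace Literature.MathematicalPhysics.QuantumFieldTheory.Balaban1983to89.B8Eq156Prop4Rec

open B7Prop1Explicit (U1)
open B7Prop2Explicit (pdev c2' le_pdev)
open B7Prop3Flat (c3)
open B7Prop2Rec (AvgClosedZ C0Z)
open B7Prop4GeneralLevelsRec (cZ gZ KZ)
open B7SectEFLinearisationRec (logCovIterZ linCovIterZ)
open B7Eq123GeneralRec (prop4_generalZ)
open B8Eq146AExpansion (iEta norm_iEta_le)
open B8Eq155JBound (wsup wsup_le)

-- `Site` alone would resolve to the torus sites of `Setup.lean`; re-export the `ℤ^d` sites of `B7Prop1Explicit`.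
export B7Prop1Explicit (Site)

variable {d : ℕ} {𝔸 : Type*} [NormedRing 𝔸] [NormOneClass 𝔸] [NormedAlgebra ℂ 𝔸] [CompleteSpace 𝔸]

/-! ## §1 (1.56) at the level `j`, record structure, for a general exponent field `B` ([3] currency) -/

/-- **(1.56), first half, [3] currency, RECORD structure** (twin of `eq156`): for `U₀` with values in a record-averaging-closed `G ≤ U1` with `pdev U₀ < α₀(Lʲ)⁻²` and an exponent
field with `sup‖B‖ ≤ b` inside the record's Prop-4 windows: at every bond of the `j`-lattice `Q_j = LʲηQ_j + C_j` and `‖C_j‖ ≤ C₂ᶻ·(Lʲb)²`,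
`C₂ᶻ = (1 + 2gZ)·2C₁·KZ²·e^{4cZ·α₀}` — `B7Eq123GeneralRec.prop4_generalZ` at `k = j`. [cite: Balaban1985RegularSpaces, (1.56) p.86; Balaban1985Averaging, (130) p.38] -/
theorem eq156 {L s : ℕ} (hLs : L = 2 * s + 1) (hs : 1 ≤ s) (hd : 1 ≤ d) {G : Subgroup 𝔸ˣ} (hG : AvgClosedZ d L G) (j : ℕ)
    (U₀ : Site d → Fin d → 𝔸ˣ) (hU₀ : ∀ x κ, U₀ x κ ∈ G) {α₀ : ℝ} (hα₀ : 0 < α₀)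
    (hα3 : C0Z d * α₀ ≤ 1 / 3) (hα4 : 4 * α₀ ≤ c2' d L) (h40 : pdev U₀ < α₀ * (((L : ℝ) ^ j)⁻¹) ^ 2)
    (B : Site d → Fin d → 𝔸) {b : ℝ} (hb : 0 ≤ b) (hB : ∀ x κ, ‖B x κ‖ ≤ b)
    (hsmall : Real.exp (4 * cZ d * α₀) * (1 + 2 * (131072 * ((d : ℝ) + 1) ^ 2) * (KZ d L) ^ 2 * ((L : ℝ) ^ j * b)) ≤ 2)
    (hc₃ : KZ d L * ((L : ℝ) ^ j * b) ≤ c3 d L) (z : Site d) (κ : Fin d) :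
    logCovIterZ L U₀ B j z κ = linCovIterZ L U₀ B j z κ + (logCovIterZ L U₀ B j z κ - linCovIterZ L U₀ B j z κ) ∧
      ‖logCovIterZ L U₀ B j z κ - linCovIterZ L U₀ B j z κ‖
        ≤ (1 + 2 * gZ d L) * (2 * (131072 * ((d : ℝ) + 1) ^ 2) * (KZ d L) ^ 2) * Real.exp (4 * cZ d * α₀)
          * ((L : ℝ) ^ j * b) ^ 2 :=
  ⟨(add_sub_cancel _ _).symm, (prop4_generalZ L hLs hs hd hG j U₀ hU₀ hα₀ hα3 hα4 h40 B hb hB hsmall hc₃ j le_rfl).2.1 z κ⟩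

/-- [3] (131) at the level `j`, record structure (twin of `norm_logCovIter_le`): `‖Q_j(U₀, ηA)‖ ≤ KZ·Lʲb`. [cite: Balaban1985RegularSpaces, (1.56) p.86; Balaban1985Averaging, (131) p.38] -/
theorem norm_logCovIter_le {L s : ℕ} (hLs : L = 2 * s + 1) (hs : 1 ≤ s) (hd : 1 ≤ d) {G : Subgroup 𝔸ˣ} (hG : AvgClosedZ d L G) (j : ℕ)
    (U₀ : Site d → Fin d → 𝔸ˣ) (hU₀ : ∀ x κ, U₀ x κ ∈ G) {α₀ : ℝ} (hα₀ : 0 < α₀)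
    (hα3 : C0Z d * α₀ ≤ 1 / 3) (hα4 : 4 * α₀ ≤ c2' d L) (h40 : pdev U₀ < α₀ * (((L : ℝ) ^ j)⁻¹) ^ 2)
    (B : Site d → Fin d → 𝔸) {b : ℝ} (hb : 0 ≤ b) (hB : ∀ x κ, ‖B x κ‖ ≤ b)
    (hsmall : Real.exp (4 * cZ d * α₀) * (1 + 2 * (131072 * ((d : ℝ) + 1) ^ 2) * (KZ d L) ^ 2 * ((L : ℝ) ^ j * b)) ≤ 2)
    (hc₃ : KZ d L * ((L : ℝ) ^ j * b) ≤ c3 d L) (z : Site d) (κ : Fin d) :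
    ‖logCovIterZ L U₀ B j z κ‖ ≤ KZ d L * ((L : ℝ) ^ j * b) :=
  (prop4_generalZ L hLs hs hd hG j U₀ hU₀ hα₀ hα3 hα4 h40 B hb hB hsmall hc₃ j le_rfl).2.2 z κ

/-! ## §2 (1.56) in B8's currency: `B = iηA`, (1.41) `|A| < α₂(Lʲη)⁻¹`, record structure -/

/-- **(1.56), «|C_j(LʲηA)| ≦ C₂|LʲηA|²», record structure** (twin of `eq156_A`) for `U₁ = e^{iηA}` with `sup|A| ≤ a`. [cite: Balaban1985RegularSpaces, (1.56) p.86] -/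
theorem eq156_A {η : ℝ} (hη : 0 ≤ η) {L s : ℕ} (hLs : L = 2 * s + 1) (hs : 1 ≤ s) (hd : 1 ≤ d) {G : Subgroup 𝔸ˣ} (hG : AvgClosedZ d L G) (j : ℕ)
    (U₀ : Site d → Fin d → 𝔸ˣ) (hU₀ : ∀ x κ, U₀ x κ ∈ G) {α₀ : ℝ} (hα₀ : 0 < α₀)
    (hα3 : C0Z d * α₀ ≤ 1 / 3) (hα4 : 4 * α₀ ≤ c2' d L) (h40 : pdev U₀ < α₀ * (((L : ℝ) ^ j)⁻¹) ^ 2)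
    (A : Site d → Fin d → 𝔸) {a : ℝ} (ha : 0 ≤ a) (hA : ∀ y κ, ‖A y κ‖ ≤ a)
    (hsmall : Real.exp (4 * cZ d * α₀) * (1 + 2 * (131072 * ((d : ℝ) + 1) ^ 2) * (KZ d L) ^ 2 * ((L : ℝ) ^ j * η * a)) ≤ 2)
    (hc₃ : KZ d L * ((L : ℝ) ^ j * η * a) ≤ c3 d L) (z : Site d) (κ : Fin d) :
    ‖logCovIterZ L U₀ (iEta η A) j z κ - linCovIterZ L U₀ (iEta η A) j z κ‖
      ≤ (1 + 2 * gZ d L) * (2 * (131072 * ((d : ℝ) + 1) ^ 2) * (KZ d L) ^ 2) * Real.exp (4 * cZ d * α₀)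
        * ((L : ℝ) ^ j * η * a) ^ 2 := by
  have hmul : (L : ℝ) ^ j * (η * a) = (L : ℝ) ^ j * η * a := by ring
  have h := (eq156 hLs hs hd hG j U₀ hU₀ hα₀ hα3 hα4 h40 (iEta η A) (mul_nonneg hη ha) (norm_iEta_le hη hA)
    (by rw [hmul]; exact hsmall) (by rw [hmul]; exact hc₃) z κ).2
  rwa [hmul] at h

/-- **(1.56), «… < C₂α₂²», record structure** (twin of `eq156_of_141`), under (1.41) `|A| ≤ α₂(Lʲη)⁻¹` read globally (`η > 0`).
[cite: Balaban1985RegularSpaces, (1.56) p.86, (1.41) p.83] -/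
theorem eq156_of_141 {η : ℝ} (hη : 0 < η) {L s : ℕ} (hLs : L = 2 * s + 1) (hs : 1 ≤ s) (hd : 1 ≤ d) {G : Subgroup 𝔸ˣ} (hG : AvgClosedZ d L G) (j : ℕ)
    (U₀ : Site d → Fin d → 𝔸ˣ) (hU₀ : ∀ x κ, U₀ x κ ∈ G) {α₀ : ℝ} (hα₀ : 0 < α₀)
    (hα3 : C0Z d * α₀ ≤ 1 / 3) (hα4 : 4 * α₀ ≤ c2' d L) (h40 : pdev U₀ < α₀ * (((L : ℝ) ^ j)⁻¹) ^ 2)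
    (A : Site d → Fin d → 𝔸) {α₂ : ℝ} (hα₂ : 0 ≤ α₂) (h41 : ∀ y κ, ‖A y κ‖ ≤ α₂ * ((L : ℝ) ^ j * η)⁻¹)
    (hsmall : Real.exp (4 * cZ d * α₀) * (1 + 2 * (131072 * ((d : ℝ) + 1) ^ 2) * (KZ d L) ^ 2 * α₂) ≤ 2)
    (hc₃ : KZ d L * α₂ ≤ c3 d L) (z : Site d) (κ : Fin d) :
    ‖logCovIterZ L U₀ (iEta η A) j z κ - linCovIterZ L U₀ (iEta η A) j z κ‖
      ≤ (1 + 2 * gZ d L) * (2 * (131072 * ((d : ℝ) + 1) ^ 2) * (KZ d L) ^ 2) * Real.exp (4 * cZ d * α₀) * α₂ ^ 2 := by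
  have hL1 : 1 ≤ L := by omega
  have hL0 : (0 : ℝ) < (L : ℝ) ^ j := by positivity
  have hscale : (L : ℝ) ^ j * η * (α₂ * ((L : ℝ) ^ j * η)⁻¹) = α₂ := by
    field_simp
  have ha : 0 ≤ α₂ * ((L : ℝ) ^ j * η)⁻¹ := mul_nonneg hα₂ (inv_nonneg.2 (by positivity))
  have h := eq156_A hη.le hLs hs hd hG j U₀ hU₀ hα₀ hα3 hα4 h40 A ha h41 (by rw [hscale]; exact hsmall)
    (by rw [hscale]; exact hc₃) z κ
  rwa [hscale] at h

/-! ## §3 «hence LʲηQ_jA = B₁, B₁ = B − C_j(LʲηA) on Λ_j, |B₁| < 2dLα₁ + C₂α₂²», record structure -/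

omit [NormOneClass 𝔸] in
/-- **`B₁ = B − C_j(LʲηA)`**, record structure (twin of `B1_eq`). [cite: Balaban1985RegularSpaces, p.86 (sentence after (1.56))] -/
theorem B1_eq (L : ℕ) (U₀ : Site d → Fin d → 𝔸ˣ) (B : Site d → Fin d → 𝔸) (j : ℕ) (z : Site d) (κ : Fin d) :
    linCovIterZ L U₀ B j z κ = logCovIterZ L U₀ B j z κ - (logCovIterZ L U₀ B j z κ - linCovIterZ L U₀ B j z κ) :=
  (sub_sub_cancel _ _).symm

/-- **«|B₁| < 2dLα₁ + C₂α₂²» at one bond of `Λ_j`**, record structure (twin of `norm_B1_lt`). [cite: Balaban1985RegularSpaces, p.86 (sentence after (1.56))] -/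
theorem norm_B1_lt {η : ℝ} (hη : 0 < η) {L s : ℕ} (hLs : L = 2 * s + 1) (hs : 1 ≤ s) (hd : 1 ≤ d) {G : Subgroup 𝔸ˣ} (hG : AvgClosedZ d L G) (j : ℕ)
    (U₀ : Site d → Fin d → 𝔸ˣ) (hU₀ : ∀ x κ, U₀ x κ ∈ G) {α₀ : ℝ} (hα₀ : 0 < α₀)
    (hα3 : C0Z d * α₀ ≤ 1 / 3) (hα4 : 4 * α₀ ≤ c2' d L) (h40 : pdev U₀ < α₀ * (((L : ℝ) ^ j)⁻¹) ^ 2)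
    (A : Site d → Fin d → 𝔸) {α₂ : ℝ} (hα₂ : 0 ≤ α₂) (h41 : ∀ y κ, ‖A y κ‖ ≤ α₂ * ((L : ℝ) ^ j * η)⁻¹)
    (hsmall : Real.exp (4 * cZ d * α₀) * (1 + 2 * (131072 * ((d : ℝ) + 1) ^ 2) * (KZ d L) ^ 2 * α₂) ≤ 2)
    (hc₃ : KZ d L * α₂ ≤ c3 d L) {α₁ : ℝ} {z : Site d} {κ : Fin d}
    (h42 : ‖logCovIterZ L U₀ (iEta η A) j z κ‖ < 2 * d * L * α₁) :
    ‖linCovIterZ L U₀ (iEta η A) j z κ‖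
      < 2 * d * L * α₁ + (1 + 2 * gZ d L) * (2 * (131072 * ((d : ℝ) + 1) ^ 2) * (KZ d L) ^ 2) * Real.exp (4 * cZ d * α₀) * α₂ ^ 2 := by
  have hC := eq156_of_141 hη hLs hs hd hG j U₀ hU₀ hα₀ hα3 hα4 h40 A hα₂ h41 hsmall hc₃ z κ
  calc ‖linCovIterZ L U₀ (iEta η A) j z κ‖
      = ‖logCovIterZ L U₀ (iEta η A) j z κ
          - (logCovIterZ L U₀ (iEta η A) j z κ - linCovIterZ L U₀ (iEta η A) j z κ)‖ := by
        rw [← B1_eq]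
    _ ≤ ‖logCovIterZ L U₀ (iEta η A) j z κ‖
          + ‖logCovIterZ L U₀ (iEta η A) j z κ - linCovIterZ L U₀ (iEta η A) j z κ‖ := norm_sub_le _ _
    _ < _ := add_lt_add_of_lt_of_le h42 hC

/-- **«|B₁| < 2dLα₁ + C₂α₂²» for the sup over `Λ_j`**, record structure (twin of `wsup_B1_le`). [cite: Balaban1985RegularSpaces, p.86 (sentence after (1.56))] -/
theorem wsup_B1_le {η : ℝ} (hη : 0 < η) {L s : ℕ} (hLs : L = 2 * s + 1) (hs : 1 ≤ s) (hd : 1 ≤ d) {G : Subgroup 𝔸ˣ} (hG : AvgClosedZ d L G) (j : ℕ)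
    (U₀ : Site d → Fin d → 𝔸ˣ) (hU₀ : ∀ x κ, U₀ x κ ∈ G) {α₀ : ℝ} (hα₀ : 0 < α₀)
    (hα3 : C0Z d * α₀ ≤ 1 / 3) (hα4 : 4 * α₀ ≤ c2' d L) (h40 : pdev U₀ < α₀ * (((L : ℝ) ^ j)⁻¹) ^ 2)
    (A : Site d → Fin d → 𝔸) {α₂ : ℝ} (hα₂ : 0 ≤ α₂) (h41 : ∀ y κ, ‖A y κ‖ ≤ α₂ * ((L : ℝ) ^ j * η)⁻¹)
    (hsmall : Real.exp (4 * cZ d * α₀) * (1 + 2 * (131072 * ((d : ℝ) + 1) ^ 2) * (KZ d L) ^ 2 * α₂) ≤ 2)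
    (hc₃ : KZ d L * α₂ ≤ c3 d L) {α₁ : ℝ} (hα₁ : 0 ≤ α₁) {ι : Type*} (bond : ι → Site d × Fin d)
    (h42 : ∀ i, ‖logCovIterZ L U₀ (iEta η A) j (bond i).1 (bond i).2‖ < 2 * d * L * α₁) :
    wsup 1 (fun i => linCovIterZ L U₀ (iEta η A) j (bond i).1 (bond i).2)
      ≤ 2 * d * L * α₁ + (1 + 2 * gZ d L) * (2 * (131072 * ((d : ℝ) + 1) ^ 2) * (KZ d L) ^ 2) * Real.exp (4 * cZ d * α₀) * α₂ ^ 2 := by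
  have hL' : (0 : ℝ) ≤ (L : ℝ) := Nat.cast_nonneg L
  have hd' : (0 : ℝ) ≤ (d : ℝ) := Nat.cast_nonneg d
  have hg : 0 ≤ gZ d L := B7Prop4GeneralLevelsRec.gZ_nonneg d L
  refine wsup_le (fun i => ?_) (by positivity)
  rw [one_mul]
  exact (norm_B1_lt hη hLs hs hd hG j U₀ hU₀ hα₀ hα3 hα4 h40 A hα₂ h41 hsmall hc₃ (h42 i)).le

end Literature.MathematicalPhysics.QuantumFieldTheory.Balaban1983to89.B8Eq156Prop4Rec

end
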